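import Literature.Barriers.AtomisticToContinuum.DisorderedHarmonicChainInvGamma
import Literature.Barriers.AtomisticToContinuum.DisorderedHarmonicChainPotential
import Mathlib.MeasureTheory.Constructions.Pi
import Mathlib.MeasureTheory.Function.SpecialFunctions.Arctan
import Mathlib.MeasureTheory.Function.SpecialFunctions.Basic
import Mathlib.MeasureTheory.Integral.Prod
import HarnessLib

/-!
# Ajanki–Huveneers 2011, Prop. 4.1, II: iteration over the product law and the discharge

Companion to `DisorderedHarmonicChainInvGamma.lean` (provefact unit for
`AjankiHuveneers2011_invGammaDecay`: O. Ajanki, F. Huveneers, CMP **301** (2011) 841–883,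
arXiv:1003.1076, §4 Prop. 4.1). That file proved the one-step estimate of the corrector argument:
with `V = e^{wκG}`, `κ = 𝔼(B²)`,
`𝔼_b[(1/ahFactor(y,b)) V(f_b(y))] ≤ e^{-αw²} V(y)`, `α = κπ²/32`, uniformly in `y ∈ ℝ`.
Here:

* the chain and the amplitude split off the FIRST reduced mass: `X^x_{l+1}(b, B') = X^{f_b(x)}_l(B')`
  (`ahPhase_succ_shift` of `…Potential.lean`), `Γ^x_{n+1}(b, B') = P_n(f_b(x); B')` with the full product
  `P_n(y; B) = ∏_{l<n} ahFactor(X^y_l, B_l)` (`ig_ahGamma_succ_eq_prod`, `ig_prod_succ`);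
* measurability of the factors and the products in the masses (`ig_measurable_*`; the chain itself and
  `finExt` are `measurable_ahPhase_pi`, `measurable_finExt` of `…Potential.lean`);
* `κ = ∫b²τ > 0` and the moments `∫τ = 1`, `∫bτ = 0` turn the pointwise one-step bound into
  `∫⁻ (1/ahFactor) V(f_b(y)) dρ_B ≤ e^{-αw²} V(y)` (`ig_oneStep_lintegral`, through
  `lintegral_withDensity_eq_lintegral_mul_non_measurable₀`, no measurability in `b` needed);
* Tonelli over `ρ_B^{⊗(n+1)} = ρ_B ⊗ ρ_B^{⊗n}` (`ig_lintegral_pi_succ`, Mathlib's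
  `measurePreserving_piFinSuccAbove` at `0`) and induction give
  `𝔼[P_n(y)⁻¹ V(X^y_n)] ≤ e^{-αw²n} V(y)` (`ig_lintegral_prod_le`), whence, as `e^{-wκ} ≤ V ≤ e^{wκ}`,
  `𝔼[(Γ^x_n)⁻¹] ≤ e^{2κ+α} e^{-αw²n}` for `0 < w ≤ w₀ ≤ 1`, all `n` and all `x`
  (`ig_lintegral_ahGamma_inv_le`), i.e. **`AjankiHuveneers2011_invGammaDecay_holds`** with the
  explicit rate `α = 𝔼(B²)π²/32`.

The statement discharged is the vendored one (`DisorderedHarmonicChainPhases.lean`), unchanged;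
the route (multiplicative corrector) differs from the paper's (Freedman/Azuma + `L^p`-ergodicity),
see the module docstring of `…InvGamma.lean`.

[cite: AjankiHuveneers2011, §4 Prop. 4.1 eq. (4.1)]
-/

noncomputable section

open Real MeasureTheory ENNReal

namespace Literature.Barriers.AtomisticToContinuum.HeatConduction

/-! ### Splitting off the first reduced mass -/

/-- `Γ^x_{n+1}(B) = P_n(f_{B_1}(x); θB)` with the full product `P_n(y; B) = ∏_{l<n} ahFactor(X^y_l, B_l)`.
[cite: AjankiHuveneers2011, Prop. 3.5 eq. (3.14)] -/
theorem ig_ahGamma_succ_eq_prod (w x : ℝ) (B : ℕ → ℝ) (n : ℕ) :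
    ahGamma w x B (n + 1) = ∏ l ∈ Finset.range n,
      ahFactor w (ahPhase w (ahStep w (B 0) x) (fun k => B (k + 1)) l) (B (l + 1)) := by
  rw [ahGamma, Finset.prod_Ico_eq_prod_range, Nat.add_sub_cancel]
  refine Finset.prod_congr rfl fun k _ => ?_
  rw [show 1 + k = k + 1 from add_comm 1 k, ahPhase_succ_shift]

/-- `P_{n+1}(y; B) = ahFactor(y, B_1) · P_n(f_{B_1}(y); θB)`. [cite: AjankiHuveneers2011, Prop. 3.5 eq. (3.14)] -/
theorem ig_prod_succ (w y : ℝ) (B : ℕ → ℝ) (n : ℕ) :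
    ∏ l ∈ Finset.range (n + 1), ahFactor w (ahPhase w y B l) (B l) =
      ahFactor w y (B 0) * ∏ l ∈ Finset.range n,
        ahFactor w (ahPhase w (ahStep w (B 0) y) (fun k => B (k + 1)) l) (B (l + 1)) := by
  rw [Finset.prod_range_succ']
  simp only [ahPhase_zero, ahPhase_succ_shift]
  ring

/-! ### Measurability in the reduced masses -/

section Measurability

variable {α : Type*} [MeasurableSpace α] {X f : α → ℝ}

/-- `a ↦ Φ(X(a), f(a))` is measurable for measurable `X`, `f`. [folklore] -/
theorem ig_measurable_ahPhi (hX : Measurable X) (hf : Measurable f) (w : ℝ) :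
    Measurable fun a => ahPhi w (X a) (f a) := by
  unfold ahPhi ahNum ahDen
  fun_prop

/-- `a ↦ f_{f(a)}(X(a))` is measurable for measurable `X`, `f`. [folklore] -/
theorem ig_measurable_ahStep (hX : Measurable X) (hf : Measurable f) (w : ℝ) :
    Measurable fun a => ahStep w (f a) (X a) := by
  unfold ahStep
  exact (hX.add_const _).add (ig_measurable_ahPhi hX hf w)

/-- `a ↦ ahFactor(X(a), f(a))` is measurable for measurable `X`, `f`. [folklore] -/
theorem ig_measurable_ahFactor (hX : Measurable X) (hf : Measurable f) (w : ℝ) :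
    Measurable fun a => ahFactor w (X a) (f a) := by
  unfold ahFactor
  refine Measurable.ite ?_ measurable_const ?_
  · exact measurableSet_eq_fun (by fun_prop) measurable_const
  · refine Measurable.div (by fun_prop) ?_
    exact Real.measurable_sin.comp (measurable_const.mul (hX.add (ig_measurable_ahPhi hX hf w)))

end Measurability

/-- The shifted phase chain `X^{f_{B_1}(x)}(θB)` is measurable in the masses. [folklore] -/
theorem ig_measurable_ahPhase_shift (w x : ℝ) (n l : ℕ) :
    Measurable fun B : Fin n → ℝ => ahPhase w (ahStep w (finExt B 0) x) (fun k => finExt B (k + 1)) l := by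
  have : (fun B : Fin n → ℝ => ahPhase w (ahStep w (finExt B 0) x) (fun k => finExt B (k + 1)) l) =
      fun B => ahPhase w x (finExt B) (l + 1) := by
    funext B; exact (ahPhase_succ_shift w x (finExt B) l).symm
  rw [this]
  exact measurable_ahPhase_pi w x (l + 1)

/-- The full product `P_m(y; B)` is measurable in the masses. [folklore] -/
theorem ig_measurable_prod (w y : ℝ) (n : ℕ) :
    ∀ m, Measurable fun B : Fin n → ℝ =>
      ∏ l ∈ Finset.range m, ahFactor w (ahPhase w y (finExt B) l) (finExt B l)
  | 0 => by simp
  | m + 1 => by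
    simp_rw [Finset.prod_range_succ]
    exact (ig_measurable_prod w y n m).mul
      (ig_measurable_ahFactor (measurable_ahPhase_pi w y m) (measurable_finExt m) w)

/-- The shifted product `P_m(f_{B_1}(x); θB)` is measurable in the masses. [folklore] -/
theorem ig_measurable_prod_shift (w x : ℝ) (n : ℕ) :
    ∀ m, Measurable fun B : Fin n → ℝ => ∏ l ∈ Finset.range m,
      ahFactor w (ahPhase w (ahStep w (finExt B 0) x) (fun k => finExt B (k + 1)) l) (finExt B (l + 1))
  | 0 => by simp
  | m + 1 => by
    simp_rw [Finset.prod_range_succ]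
    exact (ig_measurable_prod_shift w x n m).mul
      (ig_measurable_ahFactor (ig_measurable_ahPhase_shift w x n m) (measurable_finExt (m + 1)) w)

/-- The amplitude `Γ^x_m` is measurable in the masses. [folklore] -/
theorem ig_measurable_ahGamma (w x : ℝ) (n : ℕ) :
    ∀ m, Measurable fun B : Fin n → ℝ => ahGamma w x (finExt B) m
  | 0 => by simp [ahGamma]
  | m + 1 => by
    have h : (fun B : Fin n → ℝ => ahGamma w x (finExt B) (m + 1)) = fun B =>
        ∏ l ∈ Finset.range m, ahFactor w (ahPhase w (ahStep w (finExt B 0) x)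
          (fun k => finExt B (k + 1)) l) (finExt B (l + 1)) := by
      funext B; exact ig_ahGamma_succ_eq_prod w x (finExt B) m
    rw [h]
    exact ig_measurable_prod_shift w x n m

/-- The corrector is measurable. [folklore] -/
theorem ig_measurable_igCorr : Measurable igCorr := by
  unfold igCorr
  fun_prop

/-! ### Tonelli over `ρ^{⊗(m+1)} = ρ ⊗ ρ^{⊗m}` -/

/-- Integration against `ν^{⊗(m+1)}` on `Fin (m+1) → ℝ` is integration against `ν^{⊗m}` of
`b :: y` followed by integration in the first coordinate `b` (`measurePreserving_piFinSuccAbove`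
at `0`, Tonelli). [folklore] -/
theorem ig_lintegral_pi_succ (ν : Measure ℝ) [SigmaFinite ν] (m : ℕ)
    {g : (Fin (m + 1) → ℝ) → ℝ≥0∞} (hg : Measurable g) :
    ∫⁻ x, g x ∂(Measure.pi fun _ : Fin (m + 1) => ν) =
      ∫⁻ b, ∫⁻ y, g (Fin.cons b y) ∂(Measure.pi fun _ : Fin m => ν) ∂ν := by
  have hmp := MeasurePreserving.symm _ (measurePreserving_piFinSuccAbove (fun _ : Fin (m + 1) => ν) 0)
  rw [← hmp.lintegral_comp hg,
    lintegral_prod (fun p : ℝ × (Fin m → ℝ) => g ((MeasurableEquiv.piFinSuccAbove (fun _ => ℝ) 0).symm p))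
      (hg.comp hmp.measurable).aemeasurable]
  refine lintegral_congr fun b => lintegral_congr fun y => ?_
  rw [MeasurableEquiv.piFinSuccAbove_symm_apply]
  simp [Fin.insertNthEquiv, Fin.insertNth_zero']

/-! ### The reduced law: integrability, moments, `𝔼(B²) > 0` -/

/-- `s ↦ s^k τ(s)` is integrable (continuous on the compact support). [folklore] -/
theorem ig_integrable_pow_mul {τ : ℝ → ℝ} {bm bp : ℝ} (hτ : ReducedLawHyp τ bm bp) (k : ℕ) :
    Integrable fun s => s ^ k * τ s := by
  have hsupp : Function.support (fun s => s ^ k * τ s) ⊆ Set.Icc bm bp := by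
    intro s hs
    by_contra h
    exact hs (by simp [hτ.eq_zero s h])
  rw [← integrableOn_iff_integrable_of_support_subset hsupp]
  exact ContinuousOn.integrableOn_compact isCompact_Icc
    (((continuous_pow k).continuousOn).mul hτ.continuousOn)

/-- **`𝔼(B²) > 0`**: a probability density cannot vanish a.e. [folklore] -/
theorem ig_variance_pos {τ : ℝ → ℝ} {bm bp : ℝ} (hτ : ReducedLawHyp τ bm bp) :
    0 < ∫ s, s ^ 2 * τ s := by
  have hint := ig_integrable_pow_mul hτ 2
  have hnn : 0 ≤ fun s => s ^ 2 * τ s := fun s => mul_nonneg (sq_nonneg s) (hτ.nonneg s)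
  rw [integral_pos_iff_support_of_nonneg hnn hint]
  by_contra h0
  have hz : volume (Function.support fun s => s ^ 2 * τ s) = 0 :=
    nonpos_iff_eq_zero.mp (not_lt.mp h0)
  have hsub : Function.support τ ⊆ (Function.support fun s => s ^ 2 * τ s) ∪ {0} := by
    intro s hs
    by_cases h : s = 0
    · exact Or.inr h
    · exact Or.inl (mul_ne_zero (pow_ne_zero 2 h) hs)
  have hτ0 : volume (Function.support τ) = 0 :=
    measure_mono_null hsub (measure_union_null hz (measure_singleton 0))
  have hae : ∀ᵐ s ∂(volume : Measure ℝ), τ s = 0 := by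
    rw [ae_iff]
    simpa [Function.support] using hτ0
  have h1 := hτ.integral_eq_one
  rw [integral_eq_zero_of_ae hae] at h1
  exact zero_ne_one h1

/-- The moments turn a quadratic polynomial into `A₀ + κA₂`: `∫ (A₀ + A₁b + A₂b²) τ = A₀ + A₂ ∫b²τ`.
[cite: AjankiHuveneers2011, §2 (¶1: `𝔼B = 0`)] -/
theorem ig_integral_quadratic {τ : ℝ → ℝ} {bm bp : ℝ} (hτ : ReducedLawHyp τ bm bp) (A₀ A₁ A₂ : ℝ) :
    ∫ b, (A₀ + A₁ * b + A₂ * b ^ 2) * τ b = A₀ + A₂ * ∫ b, b ^ 2 * τ b := by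
  have h0 := hτ.integrable
  have h1 : Integrable fun b => b * τ b := by simpa using ig_integrable_pow_mul hτ 1
  have h2 := ig_integrable_pow_mul hτ 2
  have hsplit : (fun b => (A₀ + A₁ * b + A₂ * b ^ 2) * τ b) =
      fun b => (A₀ * τ b + A₁ * (b * τ b)) + A₂ * (b ^ 2 * τ b) := by
    funext b; ring
  have h01 : Integrable fun b => A₀ * τ b + A₁ * (b * τ b) := (h0.const_mul A₀).add (h1.const_mul A₁)
  have e1 : ∫ b, (A₀ * τ b + A₁ * (b * τ b)) + A₂ * (b ^ 2 * τ b) =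
      (∫ b, A₀ * τ b + A₁ * (b * τ b)) + ∫ b, A₂ * (b ^ 2 * τ b) := integral_add h01 (h2.const_mul A₂)
  have e2 : ∫ b, A₀ * τ b + A₁ * (b * τ b) = (∫ b, A₀ * τ b) + ∫ b, A₁ * (b * τ b) :=
    integral_add (h0.const_mul A₀) (h1.const_mul A₁)
  rw [hsplit, e1, e2, integral_const_mul, integral_const_mul, integral_const_mul, hτ.integral_eq_one,
    hτ.mean_zero]
  ring

/-- The quadratic polynomial times `τ` is integrable. [folklore] -/
theorem ig_integrable_quadratic {τ : ℝ → ℝ} {bm bp : ℝ} (hτ : ReducedLawHyp τ bm bp) (A₀ A₁ A₂ : ℝ) :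
    Integrable fun b => (A₀ + A₁ * b + A₂ * b ^ 2) * τ b := by
  have h0 := hτ.integrable
  have h1 : Integrable fun b => b * τ b := by simpa using ig_integrable_pow_mul hτ 1
  have h2 := ig_integrable_pow_mul hτ 2
  have hsplit : (fun b => (A₀ + A₁ * b + A₂ * b ^ 2) * τ b) =
      fun b => (A₀ * τ b + A₁ * (b * τ b)) + A₂ * (b ^ 2 * τ b) := by
    funext b; ring
  rw [hsplit]
  exact ((h0.const_mul A₀).add (h1.const_mul A₁)).add (h2.const_mul A₂)

/-! ### The one-step estimate against the reduced law -/

/-- **One step, integrated**: for `0 < w ≤ w₀` and every `y`,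
`∫⁻ (1/ahFactor(y,b)) e^{wκG(f_b(y))} dρ_B(b) ≤ e^{-κπ²w²/32} e^{wκG(y)}` (`κ = 𝔼B²`), and the
factors are positive `ρ_B`-relevantly (on `[b₋, b₊]`). [cite: AjankiHuveneers2011, §4 Prop. 4.1 (proof)] -/
theorem ig_oneStep_lintegral {τ : ℝ → ℝ} {bm bp : ℝ} (hτ : ReducedLawHyp τ bm bp)
    (ρB : Measure ℝ) (hρ : ρB = volume.withDensity fun s => ENNReal.ofReal (τ s))
    {κ : ℝ} (hκ : κ = ∫ s, s ^ 2 * τ s) :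
    ∃ w₀ : ℝ, 0 < w₀ ∧ w₀ ≤ 1 ∧ ∀ w ∈ Set.Ioc 0 w₀,
      (∀ x : ℝ, ∀ b ∈ Set.Icc bm bp, 0 < ahFactor w x b) ∧
      ∀ y : ℝ,
        ∫⁻ b, ENNReal.ofReal (|(ahFactor w y b)⁻¹| * Real.exp (w * κ * igCorr (ahStep w b y))) ∂ρB ≤
          ENNReal.ofReal (Real.exp (-(κ * π ^ 2 / 32 * w ^ 2)) * Real.exp (w * κ * igCorr y)) := by
  have hκpos : 0 < κ := hκ ▸ ig_variance_pos hτ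
  obtain ⟨w₀, hw₀, hw₀1, K, hK, hpt⟩ := ig_oneStep_pointwise bm bp κ hκpos.le
  obtain ⟨w₁, hw₁, havg⟩ := ig_oneStep_avg κ K hκpos hK
  have hτm : AEMeasurable (fun s => ENNReal.ofReal (τ s)) volume :=
    (hτ.integrable).aemeasurable.ennreal_ofReal
  refine ⟨min w₀ w₁, by positivity, (min_le_left _ _).trans hw₀1, ?_⟩
  intro w hw
  obtain ⟨hw0, hwle⟩ := hw
  have hwa : w ∈ Set.Ioc 0 w₀ := ⟨hw0, hwle.trans (min_le_left _ _)⟩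
  have hwb : w ∈ Set.Ioc 0 w₁ := ⟨hw0, hwle.trans (min_le_right _ _)⟩
  refine ⟨fun x b hb => (hpt w hwa x b hb).1, fun y => ?_⟩
  -- the polynomial majorant and its coefficients
  set S := Real.sin (π * y) with hS
  set C := Real.cos (π * y) with hC
  set V := Real.exp (w * κ * igCorr y) with hV
  have hV0 : 0 < V := Real.exp_pos _
  set A₀ := 1 + w ^ 2 * κ * igCorrDeriv y + K * w ^ 3 with hA₀
  set A₁ := 2 * igC w * S * C + w ^ 2 * κ * S ^ 2 * igCorrDeriv y with hA₁
  set A₂ := igC w ^ 2 * S ^ 2 * (6 * C ^ 2 - 2) with hA₂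
  set F : ℝ → ℝ := fun b => |(ahFactor w y b)⁻¹| * Real.exp (w * κ * igCorr (ahStep w b y)) with hF
  have hpoly : ∀ b, 1 + 2 * igC w * b * S * C + igC w ^ 2 * b ^ 2 * S ^ 2 * (6 * C ^ 2 - 2) +
      w ^ 2 * κ * (1 + b * S ^ 2) * igCorrDeriv y + K * w ^ 3 = A₀ + A₁ * b + A₂ * b ^ 2 := by
    intro b; rw [hA₀, hA₁, hA₂]; ring
  -- pointwise: τ F ≤ τ (A₀ + A₁ b + A₂ b²) V, and the right side is ≥ 0
  have hpw : ∀ b, τ b * F b ≤ τ b * ((A₀ + A₁ * b + A₂ * b ^ 2) * V) ∧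
      0 ≤ τ b * ((A₀ + A₁ * b + A₂ * b ^ 2) * V) := by
    intro b
    by_cases hb : b ∈ Set.Icc bm bp
    · obtain ⟨hpos, hle⟩ := hpt w hwa y b hb
      rw [hpoly b] at hle
      have hFle : F b ≤ (A₀ + A₁ * b + A₂ * b ^ 2) * V := by
        rw [hF]
        dsimp only
        rwa [abs_of_pos (inv_pos.mpr hpos)]
      have hF0 : 0 ≤ F b := by rw [hF]; positivity
      exact ⟨mul_le_mul_of_nonneg_left hFle (hτ.nonneg b),
        mul_nonneg (hτ.nonneg b) (hF0.trans hFle)⟩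
    · rw [hτ.eq_zero b hb, zero_mul, zero_mul]
      exact ⟨le_rfl, le_rfl⟩
  have hint : Integrable fun b => τ b * ((A₀ + A₁ * b + A₂ * b ^ 2) * V) := by
    have := (ig_integrable_quadratic hτ A₀ A₁ A₂).mul_const V
    refine this.congr (ae_of_all _ fun b => ?_)
    simp only
    ring
  calc ∫⁻ b, ENNReal.ofReal (F b) ∂ρB
      = ∫⁻ b, ENNReal.ofReal (τ b) * ENNReal.ofReal (F b) ∂volume := by
        rw [hρ, lintegral_withDensity_eq_lintegral_mul_non_measurable₀ _ hτm
          (ae_of_all _ fun s => ENNReal.ofReal_lt_top)]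
        rfl
    _ = ∫⁻ b, ENNReal.ofReal (τ b * F b) ∂volume := by
        refine lintegral_congr fun b => ?_
        rw [ENNReal.ofReal_mul (hτ.nonneg b)]
    _ ≤ ∫⁻ b, ENNReal.ofReal (τ b * ((A₀ + A₁ * b + A₂ * b ^ 2) * V)) ∂volume :=
        lintegral_mono fun b => ENNReal.ofReal_le_ofReal (hpw b).1
    _ = ENNReal.ofReal (∫ b, τ b * ((A₀ + A₁ * b + A₂ * b ^ 2) * V) ∂volume) :=
        (ofReal_integral_eq_lintegral_ofReal hint (ae_of_all _ fun b => (hpw b).2)).symm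
    _ = ENNReal.ofReal ((A₀ + A₂ * κ) * V) := by
        congr 1
        have : (fun b => τ b * ((A₀ + A₁ * b + A₂ * b ^ 2) * V)) =
            fun b => V * ((A₀ + A₁ * b + A₂ * b ^ 2) * τ b) := by
          funext b; ring
        rw [this, integral_const_mul, ig_integral_quadratic hτ, ← hκ]
        ring
    _ ≤ ENNReal.ofReal (Real.exp (-(κ * π ^ 2 / 32 * w ^ 2)) * V) := by
        refine ENNReal.ofReal_le_ofReal (mul_le_mul_of_nonneg_right ?_ hV0.le)
        have h := havg w hwb y
        rw [hA₀, hA₂]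
        linarith

/-! ### Iteration -/

/-- **The multiplicative supermartingale estimate**: for `0 < w ≤ w₀`, every `n` and every `y`,
`𝔼[ |P_n(y; B)⁻¹| V(X^y_n) ] ≤ e^{-αw²n} V(y)` over `B ∼ ρ_B^{⊗n}`, `α = κπ²/32`, by induction on
`n` splitting off the first mass. [cite: AjankiHuveneers2011, §4 Prop. 4.1 (proof)] -/
theorem ig_lintegral_prod_le {τ : ℝ → ℝ} {bm bp : ℝ} (hτ : ReducedLawHyp τ bm bp)
    (ρB : Measure ℝ) [IsProbabilityMeasure ρB]
    (hρ : ρB = volume.withDensity fun s => ENNReal.ofReal (τ s)) {κ : ℝ} (hκ : κ = ∫ s, s ^ 2 * τ s) :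
    ∃ w₀ : ℝ, 0 < w₀ ∧ w₀ ≤ 1 ∧ ∀ w ∈ Set.Ioc 0 w₀, ∀ n : ℕ, ∀ y : ℝ,
      ∫⁻ B : Fin n → ℝ, ENNReal.ofReal
          (|(∏ l ∈ Finset.range n, ahFactor w (ahPhase w y (finExt B) l) (finExt B l))⁻¹| *
            Real.exp (w * κ * igCorr (ahPhase w y (finExt B) n))) ∂(Measure.pi fun _ : Fin n => ρB) ≤
        ENNReal.ofReal (Real.exp (-(κ * π ^ 2 / 32 * w ^ 2)) ^ n * Real.exp (w * κ * igCorr y)) := by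
  obtain ⟨w₀, hw₀, hw₀1, hstep⟩ := ig_oneStep_lintegral hτ ρB hρ hκ
  refine ⟨w₀, hw₀, hw₀1, ?_⟩
  intro w hw n
  obtain ⟨-, hone⟩ := hstep w hw
  set θ := Real.exp (-(κ * π ^ 2 / 32 * w ^ 2)) with hθ
  have hθ0 : 0 < θ := Real.exp_pos _
  induction n with
  | zero =>
    intro y
    simp
  | succ n ih =>
    intro y
    -- the integrand on `Fin (n+1) → ℝ` and its measurability
    set g : (Fin (n + 1) → ℝ) → ℝ≥0∞ := fun B => ENNReal.ofReal
      (|(∏ l ∈ Finset.range (n + 1), ahFactor w (ahPhase w y (finExt B) l) (finExt B l))⁻¹| *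
        Real.exp (w * κ * igCorr (ahPhase w y (finExt B) (n + 1)))) with hg
    have hgm : Measurable g := by
      refine ENNReal.measurable_ofReal.comp ?_
      refine Measurable.mul ?_ ?_
      · exact continuous_abs.measurable.comp (ig_measurable_prod w y (n + 1) (n + 1)).inv
      · exact Real.measurable_exp.comp (measurable_const.mul
          (ig_measurable_igCorr.comp (measurable_ahPhase_pi w y (n + 1))))
    -- pointwise identity after splitting off the first mass
    have hcons : ∀ (b : ℝ) (B' : Fin n → ℝ), g (Fin.cons b B') =
        ENNReal.ofReal |(ahFactor w y b)⁻¹| * ENNReal.ofReal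
          (|(∏ l ∈ Finset.range n, ahFactor w (ahPhase w (ahStep w b y) (finExt B') l) (finExt B' l))⁻¹| *
            Real.exp (w * κ * igCorr (ahPhase w (ahStep w b y) (finExt B') n))) := by
      intro b B'
      rw [hg]
      dsimp only
      rw [ig_prod_succ, ahPhase_succ_shift, finExt_cons_zero]
      simp only [finExt_cons_succ]
      rw [mul_inv, abs_mul, mul_assoc, ENNReal.ofReal_mul (abs_nonneg _)]
    rw [ig_lintegral_pi_succ ρB n hgm]
    calc ∫⁻ b, ∫⁻ B', g (Fin.cons b B') ∂(Measure.pi fun _ : Fin n => ρB) ∂ρB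
        = ∫⁻ b, ENNReal.ofReal |(ahFactor w y b)⁻¹| * ∫⁻ B', ENNReal.ofReal
            (|(∏ l ∈ Finset.range n, ahFactor w (ahPhase w (ahStep w b y) (finExt B') l) (finExt B' l))⁻¹| *
              Real.exp (w * κ * igCorr (ahPhase w (ahStep w b y) (finExt B') n)))
            ∂(Measure.pi fun _ : Fin n => ρB) ∂ρB := by
          refine lintegral_congr fun b => ?_
          rw [← lintegral_const_mul' _ _ ENNReal.ofReal_ne_top]
          exact lintegral_congr fun B' => hcons b B'
      _ ≤ ∫⁻ b, ENNReal.ofReal |(ahFactor w y b)⁻¹| *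
            ENNReal.ofReal (θ ^ n * Real.exp (w * κ * igCorr (ahStep w b y))) ∂ρB :=
          lintegral_mono fun b => mul_le_mul' le_rfl (ih (ahStep w b y))
      _ = ENNReal.ofReal (θ ^ n) *
            ∫⁻ b, ENNReal.ofReal (|(ahFactor w y b)⁻¹| * Real.exp (w * κ * igCorr (ahStep w b y))) ∂ρB := by
          rw [← lintegral_const_mul' _ _ ENNReal.ofReal_ne_top]
          refine lintegral_congr fun b => ?_
          rw [ENNReal.ofReal_mul (pow_nonneg hθ0.le n), ENNReal.ofReal_mul (abs_nonneg _)]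
          ring
      _ ≤ ENNReal.ofReal (θ ^ n) * ENNReal.ofReal (θ * Real.exp (w * κ * igCorr y)) :=
          mul_le_mul' le_rfl (hone y)
      _ = ENNReal.ofReal (θ ^ (n + 1) * Real.exp (w * κ * igCorr y)) := by
          rw [← ENNReal.ofReal_mul (pow_nonneg hθ0.le n), pow_succ]
          ring_nf

/-- **The bound on `𝔼|1/Γ^x_n|` in `ℝ≥0∞` form**: for `0 < w ≤ w₀ ≤ 1`, all `n`, all `x`,
`∫⁻ |(Γ^x_n)⁻¹| dρ_B^{⊗n} ≤ e^{2κ + α} e^{-αw²n}`, `α = κπ²/32`, `κ = 𝔼(B²)`.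
[cite: AjankiHuveneers2011, §4 Prop. 4.1 eq. (4.1)] -/
theorem ig_lintegral_ahGamma_inv_le {τ : ℝ → ℝ} {bm bp : ℝ} (hτ : ReducedLawHyp τ bm bp)
    (ρB : Measure ℝ) [IsProbabilityMeasure ρB]
    (hρ : ρB = volume.withDensity fun s => ENNReal.ofReal (τ s)) {κ : ℝ} (hκ : κ = ∫ s, s ^ 2 * τ s) :
    ∃ w₀ : ℝ, 0 < w₀ ∧ ∀ w ∈ Set.Ioc 0 w₀, ∀ n : ℕ, ∀ x : ℝ,
      ∫⁻ B : Fin n → ℝ, ENNReal.ofReal |(ahGamma w x (finExt B) n)⁻¹| ∂(Measure.pi fun _ : Fin n => ρB) ≤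
        ENNReal.ofReal (Real.exp (2 * κ + κ * π ^ 2 / 32) * Real.exp (-(κ * π ^ 2 / 32 * w ^ 2 * n))) := by
  obtain ⟨w₀, hw₀, hw₀1, hprod⟩ := ig_lintegral_prod_le hτ ρB hρ hκ
  have hκpos : 0 < κ := hκ ▸ ig_variance_pos hτ
  refine ⟨w₀, hw₀, ?_⟩
  intro w hw n x
  obtain ⟨hw0, hwle⟩ := hw
  have hw1 : w ≤ 1 := hwle.trans hw₀1
  set α := κ * π ^ 2 / 32 with hα
  have hα0 : 0 ≤ α := by positivity
  set θ := Real.exp (-(α * w ^ 2)) with hθ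
  have hθ0 : 0 < θ := Real.exp_pos _
  -- bounds on the corrector weight
  have hVbd : ∀ z : ℝ, Real.exp (-(w * κ)) ≤ Real.exp (w * κ * igCorr z) ∧
      Real.exp (w * κ * igCorr z) ≤ Real.exp (w * κ) := by
    intro z
    have h := abs_le.mp (abs_igCorr_le z)
    have hwκ : 0 ≤ w * κ := by positivity
    constructor
    · apply Real.exp_le_exp.mpr; nlinarith
    · apply Real.exp_le_exp.mpr; nlinarith
  cases n with
  | zero =>
    -- `Γ_0 = 1`
    have h1 : ∀ B : Fin 0 → ℝ, ahGamma w x (finExt B) 0 = 1 := fun B => by simp [ahGamma]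
    simp only [h1, inv_one, abs_one, ENNReal.ofReal_one, lintegral_const, measure_univ, mul_one,
      Nat.cast_zero, mul_zero, neg_zero, Real.exp_zero]
    exact ENNReal.one_le_ofReal.mpr (Real.one_le_exp (by positivity))
  | succ n =>
    set g : (Fin (n + 1) → ℝ) → ℝ≥0∞ := fun B => ENNReal.ofReal |(ahGamma w x (finExt B) (n + 1))⁻¹| with hg
    have hgm : Measurable g :=
      ENNReal.measurable_ofReal.comp (continuous_abs.measurable.comp (ig_measurable_ahGamma w x (n + 1) (n + 1)).inv)
    have hcons : ∀ (b : ℝ) (B' : Fin n → ℝ), g (Fin.cons b B') =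
        ENNReal.ofReal |(∏ l ∈ Finset.range n,
          ahFactor w (ahPhase w (ahStep w b x) (finExt B') l) (finExt B' l))⁻¹| := by
      intro b B'
      rw [hg]
      dsimp only
      rw [ig_ahGamma_succ_eq_prod, finExt_cons_zero]
      simp only [finExt_cons_succ]
    -- `|P⁻¹| ≤ |P⁻¹| V(X_n) e^{wκ}`
    have hdom : ∀ (y : ℝ) (B' : Fin n → ℝ),
        ENNReal.ofReal |(∏ l ∈ Finset.range n, ahFactor w (ahPhase w y (finExt B') l) (finExt B' l))⁻¹| ≤
          ENNReal.ofReal (|(∏ l ∈ Finset.range n, ahFactor w (ahPhase w y (finExt B') l) (finExt B' l))⁻¹| *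
              Real.exp (w * κ * igCorr (ahPhase w y (finExt B') n))) * ENNReal.ofReal (Real.exp (w * κ)) := by
      intro y B'
      rw [← ENNReal.ofReal_mul (by positivity)]
      refine ENNReal.ofReal_le_ofReal ?_
      set P := |(∏ l ∈ Finset.range n, ahFactor w (ahPhase w y (finExt B') l) (finExt B' l))⁻¹|
      have hP : 0 ≤ P := abs_nonneg _
      have h1 : 1 ≤ Real.exp (w * κ * igCorr (ahPhase w y (finExt B') n)) * Real.exp (w * κ) := by
        rw [← Real.exp_add]
        apply Real.one_le_exp
        have := (hVbd (ahPhase w y (finExt B') n)).1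
        have h := abs_le.mp (abs_igCorr_le (ahPhase w y (finExt B') n))
        nlinarith [mul_pos hw0 hκpos]
      calc P = P * 1 := (mul_one P).symm
        _ ≤ P * (Real.exp (w * κ * igCorr (ahPhase w y (finExt B') n)) * Real.exp (w * κ)) :=
            mul_le_mul_of_nonneg_left h1 hP
        _ = _ := by ring
    change ∫⁻ B, g B ∂(Measure.pi fun _ : Fin (n + 1) => ρB) ≤ _
    rw [ig_lintegral_pi_succ ρB n hgm]
    calc ∫⁻ b, ∫⁻ B', g (Fin.cons b B') ∂(Measure.pi fun _ : Fin n => ρB) ∂ρB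
        ≤ ∫⁻ b, (∫⁻ B', ENNReal.ofReal
            (|(∏ l ∈ Finset.range n, ahFactor w (ahPhase w (ahStep w b x) (finExt B') l) (finExt B' l))⁻¹| *
              Real.exp (w * κ * igCorr (ahPhase w (ahStep w b x) (finExt B') n)))
              ∂(Measure.pi fun _ : Fin n => ρB)) * ENNReal.ofReal (Real.exp (w * κ)) ∂ρB := by
          refine lintegral_mono fun b => ?_
          rw [← lintegral_mul_const' _ _ ENNReal.ofReal_ne_top]
          refine lintegral_mono fun B' => ?_
          rw [hcons]
          exact hdom _ _
      _ ≤ ∫⁻ b, ENNReal.ofReal (θ ^ n * Real.exp (w * κ * igCorr (ahStep w b x))) *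
            ENNReal.ofReal (Real.exp (w * κ)) ∂ρB :=
          lintegral_mono fun b => mul_le_mul' (hprod w ⟨hw0, hwle⟩ n (ahStep w b x)) le_rfl
      _ ≤ ∫⁻ _b, ENNReal.ofReal (θ ^ n * Real.exp (w * κ)) * ENNReal.ofReal (Real.exp (w * κ)) ∂ρB := by
          refine lintegral_mono fun b => mul_le_mul' (ENNReal.ofReal_le_ofReal ?_) le_rfl
          exact mul_le_mul_of_nonneg_left (hVbd _).2 (pow_nonneg hθ0.le n)
      _ = ENNReal.ofReal (θ ^ n * Real.exp (w * κ)) * ENNReal.ofReal (Real.exp (w * κ)) := by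
          rw [lintegral_const, measure_univ, mul_one]
      _ = ENNReal.ofReal (θ ^ n * Real.exp (w * κ) * Real.exp (w * κ)) := by
          rw [← ENNReal.ofReal_mul (by positivity)]
      _ ≤ ENNReal.ofReal (Real.exp (2 * κ + α) * Real.exp (-(α * w ^ 2 * (n + 1 : ℕ)))) := by
          refine ENNReal.ofReal_le_ofReal ?_
          -- θ^n = e^{-αw²n} = e^{-αw²(n+1)} e^{αw²} ≤ e^{-αw²(n+1)} e^{α}; e^{wκ}² ≤ e^{2κ}
          have hθn : θ ^ n = Real.exp (-(α * w ^ 2 * (n + 1 : ℕ))) * Real.exp (α * w ^ 2) := by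
            rw [hθ, ← Real.exp_nat_mul, ← Real.exp_add]
            congr 1
            push_cast
            ring
          rw [hθn]
          have h2 : Real.exp (α * w ^ 2) * (Real.exp (w * κ) * Real.exp (w * κ)) ≤ Real.exp (2 * κ + α) := by
            rw [← Real.exp_add, ← Real.exp_add]
            apply Real.exp_le_exp.mpr
            nlinarith [mul_le_mul_of_nonneg_left hw1 hκpos.le, mul_le_mul_of_nonneg_left hw1 hα0,
              mul_le_mul_of_nonneg_left hw1 (mul_nonneg hα0 hw0.le)]
          have h0 : 0 ≤ Real.exp (-(α * w ^ 2 * (n + 1 : ℕ))) := (Real.exp_pos _).le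
          calc Real.exp (-(α * w ^ 2 * (n + 1 : ℕ))) * Real.exp (α * w ^ 2) * Real.exp (w * κ) * Real.exp (w * κ)
              = Real.exp (-(α * w ^ 2 * (n + 1 : ℕ))) *
                  (Real.exp (α * w ^ 2) * (Real.exp (w * κ) * Real.exp (w * κ))) := by ring
            _ ≤ Real.exp (-(α * w ^ 2 * (n + 1 : ℕ))) * Real.exp (2 * κ + α) :=
                mul_le_mul_of_nonneg_left h2 h0
            _ = Real.exp (2 * κ + α) * Real.exp (-(α * w ^ 2 * (n + 1 : ℕ))) := mul_comm _ _

end Literature.Barriers.AtomisticToContinuum.HeatConduction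

namespace Literature.Barriers.AtomisticToContinuum

open HeatConduction

/-- **Prop. 4.1 of Ajanki–Huveneers discharged**: `sup_x 𝔼(1/Γ^x_n) ≤ C e^{-αw²n}` for
`0 < w ≤ w₀`, with `α = 𝔼(B²)π²/32` and `C = e^{2𝔼(B²) + α}` (multiplicative-corrector proof, see
`DisorderedHarmonicChainInvGamma.lean`). [cite: AjankiHuveneers2011, §4 Prop. 4.1 eq. (4.1)] -/
theorem AjankiHuveneers2011_invGammaDecay_holds : AjankiHuveneers2011_invGammaDecay := by
  intro τ bm bp hτ ρB _ hρ
  obtain ⟨w₀, hw₀, hmain⟩ := ig_lintegral_ahGamma_inv_le hτ ρB hρ (κ := ∫ s, s ^ 2 * τ s) rfl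
  set κ := ∫ s, s ^ 2 * τ s with hκ
  refine ⟨w₀, hw₀, κ * π ^ 2 / 32, ?_, Real.exp (2 * κ + κ * π ^ 2 / 32), ?_⟩
  · have := ig_variance_pos hτ
    positivity
  intro w hw n x
  have hbound := hmain w hw n x
  set f : (Fin n → ℝ) → ℝ := fun B => (ahGamma w x (finExt B) n)⁻¹ with hf
  have hfm : Measurable f := (ig_measurable_ahGamma w x n n).inv
  have hC0 : 0 ≤ Real.exp (2 * κ + κ * π ^ 2 / 32) * Real.exp (-(κ * π ^ 2 / 32 * w ^ 2 * n)) := by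
    positivity
  have hfin : HasFiniteIntegral f (Measure.pi fun _ : Fin n => ρB) := by
    rw [hasFiniteIntegral_iff_norm]
    calc ∫⁻ B, ENNReal.ofReal ‖f B‖ ∂(Measure.pi fun _ : Fin n => ρB)
        = ∫⁻ B, ENNReal.ofReal |f B| ∂(Measure.pi fun _ : Fin n => ρB) := by
          simp only [Real.norm_eq_abs]
      _ ≤ _ := hbound
      _ < ⊤ := ENNReal.ofReal_lt_top
  have hint : Integrable f (Measure.pi fun _ : Fin n => ρB) := ⟨hfm.aestronglyMeasurable, hfin⟩
  refine ⟨hint, ?_⟩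
  have habs : ∫ B, |f B| ∂(Measure.pi fun _ : Fin n => ρB) ≤
      Real.exp (2 * κ + κ * π ^ 2 / 32) * Real.exp (-(κ * π ^ 2 / 32 * w ^ 2 * n)) := by
    rw [integral_eq_lintegral_of_nonneg_ae (ae_of_all _ fun B => abs_nonneg (f B))
      hint.abs.aestronglyMeasurable]
    exact ENNReal.toReal_le_of_le_ofReal hC0 hbound
  calc ∫ B, f B ∂(Measure.pi fun _ : Fin n => ρB) ≤ |∫ B, f B ∂(Measure.pi fun _ : Fin n => ρB)| :=
        le_abs_self _
    _ ≤ ∫ B, |f B| ∂(Measure.pi fun _ : Fin n => ρB) := abs_integral_le_integral_abs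
    _ ≤ _ := habs

end Literature.Barriers.AtomisticToContinuum

end
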